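import Summits.MatrixMultiplication.MatrixMultiplication.Theorems.SoloInformedFamilyWindow
import Summits.MatrixMultiplication.MatrixMultiplication.Theorems.SoloInformedCwTwoPattern
import Literature.Computability.AlgebraicComplexity.BorderRankRestriction

/-!
# The two rank strata of the carrier family: `R = R̲ = 5` off the symmetric locus, `R ≤ 4` on it

Solo deliverable (informed mode). With the uniform ceiling `R(T_{1,1,M}) ≤ 5`
(`SoloInformedFamilyWindow`) and the Koszul floor `5 ≤ R̲(T_{1,1,M})` for `M′ ≠ M′ᵀ`
(`SoloInformedCarrierKoszul`), the block-normal carriers split into exactly two strata, with no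
classification of bilinear forms used anywhere:

* `tensorRank_blockNormal_eq_five`, `algBorderRank_blockNormal_eq_five`: **`det M′ ≠ 0`,
  `M′₁₂ ≠ M′₂₁ ⇒ R(T_{1,1,M}) = R̲(T_{1,1,M}) = 5`**;
* `tensorRank_symmBlock_le_four`: **`det M′ ≠ 0`, `M′₁₂ = M′₂₁ ⇒ R(T_{1,1,M}) ≤ 4`** — a shear
  diagonalises `M′`, a diagonal scaling (two square roots) makes it `I`, and `T_{1,1,1} = T_{cw,2}`
  has the four-term torus decompositions of `SoloInformedCwTwoPattern`;
* `tensorRank_blockNormal_dichotomy`: both in one statement. The Coppersmith–Winograd stratum is the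
  closed set `{M′₁₂ = M′₂₁}`; every other member of the family has strictly larger rank and border
  rank, yet carries the same door `R̃ = 3 ⇒ ω = 2` (`SoloInformedFamilyDoorGeneral`).
-/

noncomputable section

open scoped BigOperators
open Literature.Computability.AlgebraicComplexity

namespace Summit.MatrixMultiplication.MatrixMultiplication.Theorems.CarrierFamily

/-! ## Exact values on the two strata: `R = R̲ = 5` (non-symmetric), `R ≤ 4` (symmetric) -/

/-- **Non-symmetric stratum: `R̲(T_{1,1,M}) = 5`** for every non-degenerate `M′ ≠ M′ᵀ`
(Koszul flattening floor `5 ≤ R̲` + the uniform ceiling `R ≤ 5`).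
[cite: ConnerGesmundoLandsbergVentura2022, Prop. 3.1, §5] -/
theorem algBorderRank_blockNormal_eq_five {M : Matrix (Fin 3) (Fin 3) ℂ}
    (hdet : (innerBlock M).det ≠ 0) (hsym : M 1 2 ≠ M 2 1) :
    algBorderRank (cwShapeTensor 1 1 M) = 5 :=
  le_antisymm ((algBorderRank_le_tensorRank _).trans (tensorRank_blockNormal_le_five hdet))
    (five_le_algBorderRank_cwShape hdet hsym)

/-- **Non-symmetric stratum: `R(T_{1,1,M}) = 5`.**
[cite: ConnerGesmundoLandsbergVentura2022, §5] -/
theorem tensorRank_blockNormal_eq_five {M : Matrix (Fin 3) (Fin 3) ℂ}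
    (hdet : (innerBlock M).det ≠ 0) (hsym : M 1 2 ≠ M 2 1) :
    tensorRank (cwShapeTensor 1 1 M) = 5 :=
  le_antisymm (tensorRank_blockNormal_le_five hdet)
    ((five_le_algBorderRank_cwShape hdet hsym).trans (algBorderRank_le_tensorRank _))

/-- Symmetric stratum, main case `M′₁₁ ≠ 0`: diagonalise by a shear, normalise by a diagonal
scaling, land on `T_{1,1,1} = T_{cw,2}` of rank `≤ 4`. [cite: CoppersmithWinograd1990, §6] -/
theorem tensorRank_symmBlock_le_four_of_ne {M : Matrix (Fin 3) (Fin 3) ℂ}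
    (hdet : (innerBlock M).det ≠ 0) (hsym : M 1 2 = M 2 1) (h11 : M 1 1 ≠ 0) :
    tensorRank (cwShapeTensor 1 1 M) ≤ 4 := by
  rw [det_innerBlock] at hdet
  set x : ℂ := -(M 1 2) * (M 1 1)⁻¹ with hx_def
  have hx : x * M 1 1 = -(M 1 2) := by rw [hx_def]; exact inv_mul_cancel_right₀ h11 _
  have hd : M 1 1 * (M 1 1 * x ^ 2 + (M 1 2 + M 2 1) * x + M 2 2) ≠ 0 := by
    have e : M 1 1 * (M 1 1 * x ^ 2 + (M 1 2 + M 2 1) * x + M 2 2) =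
        M 1 1 * M 2 2 - M 1 2 * M 2 1 := by linear_combination (x * M 1 1 + M 2 1) * hx
    rwa [e]
  have hd' : M 1 1 * x ^ 2 + (M 1 2 + M 2 1) * x + M 2 2 ≠ 0 := fun h => hd (by rw [h, mul_zero])
  obtain ⟨w, hw⟩ := IsAlgClosed.exists_eq_mul_self (M 1 1)
  obtain ⟨z, hz⟩ := IsAlgClosed.exists_eq_mul_self (M 1 1 * x ^ 2 + (M 1 2 + M 2 1) * x + M 2 2)
  have hw0 : w ≠ 0 := by rintro rfl; exact h11 (by rw [hw, mul_zero])
  have hz0 : z ≠ 0 := by rintro rfl; exact hd' (by rw [hz, mul_zero])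
  have hres := cwShapeTensor_restrictsTo_scale (1 : Matrix (Fin 3) (Fin 3) ℂ) (s := w) (t := z)
    (u := w⁻¹) (v := z⁻¹) (inv_mul_cancel₀ hw0) (inv_mul_cancel₀ hz0)
  have hle := tensorRank_le_of_restrictsTo_congr (M := shearBlock x M) hres
    (by simp [scaleBlock, shearBlock]; linear_combination (-1 : ℂ) * hw)
    (by simp [scaleBlock, shearBlock]; linear_combination (-1 : ℂ) * hx)
    (by simp [scaleBlock, shearBlock]; linear_combination (-1 : ℂ) * hx + hsym)
    (by simp [scaleBlock, shearBlock]; linear_combination (-1 : ℂ) * hz)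
  refine (tensorRank_le_shear M x).trans (hle.trans ?_)
  rw [cwShapeTensor_one_one_one]
  exact tensorRank_cwTensor_two_le_four

/-- Entries of the lower-sheared block. [folklore] -/
theorem lshearBlock_entries (t : ℂ) (M : Matrix (Fin 3) (Fin 3) ℂ) :
    lshearBlock t M 1 1 = M 1 1 + (M 1 2 + M 2 1) * t + M 2 2 * t ^ 2 ∧
      lshearBlock t M 1 2 = M 1 2 + M 2 2 * t ∧ lshearBlock t M 2 1 = M 2 1 + M 2 2 * t ∧
      lshearBlock t M 2 2 = M 2 2 := by
  simp [lshearBlock]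

/-- Entries of the swapped block. [folklore] -/
theorem swapBlock_entries (M : Matrix (Fin 3) (Fin 3) ℂ) :
    swapBlock M 1 1 = M 2 2 ∧ swapBlock M 1 2 = M 2 1 ∧ swapBlock M 2 1 = M 1 2 ∧
      swapBlock M 2 2 = M 1 1 := by
  simp [swapBlock]

/-- **Symmetric stratum: `R(T_{1,1,M}) ≤ 4`** for every non-degenerate symmetric `M′` (if
`M′₁₁ = 0`: swap when `M′₂₂ ≠ 0`, else a lower shear makes the corner `2M′₁₂ ≠ 0`).
[cite: CoppersmithWinograd1990, §6] -/
theorem tensorRank_symmBlock_le_four {M : Matrix (Fin 3) (Fin 3) ℂ}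
    (hdet : (innerBlock M).det ≠ 0) (hsym : M 1 2 = M 2 1) :
    tensorRank (cwShapeTensor 1 1 M) ≤ 4 := by
  by_cases h11 : M 1 1 = 0
  swap
  · exact tensorRank_symmBlock_le_four_of_ne hdet hsym h11
  rw [det_innerBlock] at hdet
  have h12 : M 1 2 ≠ 0 := by
    intro h; apply hdet; rw [h11, h]; ring
  by_cases h22 : M 2 2 = 0
  · obtain ⟨l11, l12, l21, l22⟩ := lshearBlock_entries 1 M
    refine (tensorRank_le_lshear M 1).trans (tensorRank_symmBlock_le_four_of_ne ?_ ?_ ?_)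
    · rw [det_innerBlock, l11, l12, l21, l22, h11, h22]
      intro h; apply hdet; rw [h11, h22]; linear_combination h
    · rw [l12, l21, hsym]
    · rw [l11, h11, h22]
      intro h; apply h12; linear_combination h / 2 + hsym / 2
  · obtain ⟨s11, s12, s21, s22⟩ := swapBlock_entries M
    refine (tensorRank_le_swap M).trans (tensorRank_symmBlock_le_four_of_ne ?_ ?_ ?_)
    · rw [det_innerBlock, s11, s12, s21, s22]
      intro h; apply hdet; linear_combination h
    · rw [s12, s21, hsym]
    · rw [s11]; exact h22

/-- **The family splits into exactly two rank strata**: for non-degenerate `M′`,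
`R(T_{1,1,M}) ≤ 4` if `M′` is symmetric and `R(T_{1,1,M}) = R̲(T_{1,1,M}) = 5` otherwise — the
Coppersmith–Winograd stratum is the closed set `{M′₁₂ = M′₂₁}`. [folklore] -/
theorem tensorRank_blockNormal_dichotomy {M : Matrix (Fin 3) (Fin 3) ℂ}
    (hdet : (innerBlock M).det ≠ 0) :
    (M 1 2 = M 2 1 → tensorRank (cwShapeTensor 1 1 M) ≤ 4) ∧
      (M 1 2 ≠ M 2 1 → tensorRank (cwShapeTensor 1 1 M) = 5 ∧
        algBorderRank (cwShapeTensor 1 1 M) = 5) :=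
  ⟨tensorRank_symmBlock_le_four hdet, fun h =>
    ⟨tensorRank_blockNormal_eq_five hdet h, algBorderRank_blockNormal_eq_five hdet h⟩⟩

end Summit.MatrixMultiplication.MatrixMultiplication.Theorems.CarrierFamily

end
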